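import Literature.MathematicalPhysics.QuantumLattice.InfVolFermionStateTorusLimitTwoSectorSingleAnnihilator
import HarnessLib

/-!
# The two-sector row of a PAIR ANNIHILATOR `c_{x↑}c_{y↓}` for the thermal object of record: image sector
# `(k_L − 1, k_L − 1)`, again an `S^z = 0` canonical sector

Topic `Literature/MathematicalPhysics/QuantumLattice`; complement of
`InfVolFermionStateTorusLimitTwoSectorSingleAnnihilator.lean` (template `c_{x↑}`, image sector
`(k_L − 1, k_L)`) and `…SingleCreator.lean` (`c†_{x↑}`, image `(k_L + 1, k_L)`). The pair template matters
twice for the Hubbard programme: pair operators are the charged generators of the pairing rows of a thermal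
relaxation, and their image sector `(k − 1, k − 1)` is again an `S^z = 0` CANONICAL sector — so the
companion limit `ω'` is a torus limit of `S^z = 0` canonical Gibbs mixtures, for which the general-mixture
forms of the tree's reader-law rows (charged words, spin densities `ω'(n_{0σ}) = ρ/2`,
`TorusSectorGibbsMixtureChargeRows`) apply as they stand.

* §1 the torus embedding of `A = c_{x↑}c_{y↓}` (`x, y ∈ Λ`) is the product of the two torus annihilators
  (`fermionEmbed_mul`, `fermionEmbed_annihilation`); it carries `(k, k)` into `(k − 1, k − 1)` and its
  adjoint `c†_{y↓}c†_{x↑}` carries `(k − 1, k − 1)` back (`k ≥ 1`; the ladder lemmas of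
  `HubbardSzSectorLadder` composed);
* §2 `IsTorusLimitOfMixture.re_expect_twoSector_eeb_pairAnnihilation_nonneg_of_sectorGibbs`: for every
  thermal torus limit `ω` of record (`0 < n`), every companion torus limit `ω'` along the same `Ls` of the
  canonical states of the sectors `(k_L − 1, k_L − 1)`, and `r = lim Z_{(k−1,k−1)}/Z_{(k,k)}` (the
  exponential of `β` times the canonical PAIR removal cost `F_{(k,k)} − F_{(k−1,k−1)}` — twice a chemical
  potential):
  `0 ≤ β·Re ω_{Λ₁}(P̃ᴴ(H_{Λ₁}P̃ − P̃H_{Λ₁})) − s·Re ω_{Λ₁}(P̃ᴴP̃) + q·r·Re ω'_{Λ₁}(P̃P̃ᴴ)`, `P̃ = Γ_{Λ⊆Λ₁}(c_{x↑}c_{y↓})`,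
  `e^{s−1} ≤ q`.

HONEST SCOPE: rows for pairs of states, no claim `ω' = ω`; one template. Everything is PROVED; no
definition, no named fact.

## Mathlib / tree search

REUSED: `InfVolFermionState.re_expect_twoSector_eeb_nonneg_of_canonical_limits_eventually`
(`…SingleAnnihilator`), `apply_eq_zero_off_of_mulVec_mem₂`, `mem_szSector_iff_spinConfig`,
`hubbardTorusTT'_apply_eq_zero_of_spinConfig`, `fockTranslate_apply_eq_zero_of_spinConfig`,
`IsInSector.annihilation_up/down_mulVec`, `IsInSector.creation_up/down_mulVec`, `mem_szSector_iff_isInSector`,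
`fermionEmbed_mul`, `fermionEmbed_annihilation`, `annihilation_conjTranspose`, `Matrix.conjTranspose_mul`,
`Matrix.mulVec_mulVec`, `mem_szSector_rectN_iff`. `lean search 'pairAnnihilation|pair.*twoSector'`: nothing
(2026-08-27).

## References

* O. Bratteli, D. W. Robinson, *Operator Algebras and Quantum Statistical Mechanics 2* (1997),
  Thm. 5.3.15, §5.4.2. [cite: BratteliRobinsonII1997, §5.4.2]
* H. Fawzi, O. Fawzi, S. O. Scalet (2024), Thm. 3.1, §3.2. [cite: FawziFawziScalet2024, Thm. 3.1]
* E. H. Lieb, Phys. Rev. Lett. 62 (1989) 1201, eq. (2). [cite: LiebPRL1989, proof of Theorem 1]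
-/

noncomputable section

namespace Literature.MathematicalPhysics.QuantumLattice

open Matrix Finset HubbardWave0 Literature.Probability.LatticeModels ThermodynamicLimit
open _root_.Filter
open scoped _root_.Topology ComplexOrder BigOperators

/-! ### §1 The pair annihilator: its torus embedding lowers both `N↑` and `N↓` by one -/

section Pair

variable (L : ℕ) [NeZero L]

/-- The torus embedding of the local pair annihilator `c_{x↑}c_{y↓} ∈ 𝔄_Λ` (through `𝔄_{Λ₁}`) is the product
of the torus annihilators at the image sites. [cite: ArakiMoriya2003, §4.1 Def. 4.3] -/
theorem fermionEmbed_toTorusEmb_incl_pairAnnihilation {Λ : Finset (Site 2)}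
    (h₁ : Set.InjOn (Torus.proj (d := 2) L) ↑(thicken Λ 1)) {x y : Site 2} (hx : x ∈ Λ) (hy : y ∈ Λ) :
    fermionEmbed (PolySite.toTorusEmb L h₁)
        (fermionEmbed (PolySite.incl (subset_thicken Λ 1))
          (annihilation (orb (PolySite.pt x hx) 0) * annihilation (orb (PolySite.pt y hy) 1))) =
      annihilation (orb (PolySite.toTorusEmb L h₁ (PolySite.incl (subset_thicken Λ 1) (PolySite.pt x hx))) 0) *
        annihilation (orb (PolySite.toTorusEmb L h₁ (PolySite.incl (subset_thicken Λ 1) (PolySite.pt y hy))) 1) := by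
  rw [fermionEmbed_mul, fermionEmbed_mul, fermionEmbed_annihilation, fermionEmbed_annihilation,
    fermionEmbed_annihilation, fermionEmbed_annihilation]

omit [NeZero L] in
/-- **`c_{u↑}c_{v↓}` carries the sector `(rectN n L, S^z = 0) = (k, k)` into `(k − 1, k − 1)`** (`k ≥ 1`).
[cite: LiebPRL1989, proof of Theorem 1] -/
theorem pairAnnihilation_mulVec_mem_szSector_pred {n : ℝ} (hk : 1 ≤ halfRectN n L) (u v : FermionTorus 2 L)
    (w : Fock (Orb (FermionTorus 2 L))) (hw : w ∈ szSector (rectN n L) (0 : ℝ)) :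
    (annihilation (orb u 0) * annihilation (orb v 1)) *ᵥ w ∈
      szSector ((halfRectN n L - 1) + (halfRectN n L - 1))
        ((((halfRectN n L - 1 : ℕ) : ℝ) - ((halfRectN n L - 1 : ℕ) : ℝ)) / 2) := by
  rw [mem_szSector_iff_isInSector, ← mulVec_mulVec]
  have hw' : IsInSector (halfRectN n L - 1 + 1) (halfRectN n L - 1 + 1) w := by
    rw [Nat.sub_add_cancel hk]
    exact (mem_szSector_rectN_iff n L w).1 hw
  exact (hw'.annihilation_down_mulVec v).annihilation_up_mulVec u

omit [NeZero L] in
/-- **`(c_{u↑}c_{v↓})ᴴ = c†_{v↓}c†_{u↑}` carries the sector `(k − 1, k − 1)` back into `(k, k)`** (`k ≥ 1`).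
[cite: LiebPRL1989, proof of Theorem 1] -/
theorem pairAnnihilation_conjTranspose_mulVec_mem_szSector_rectN {n : ℝ} (hk : 1 ≤ halfRectN n L)
    (u v : FermionTorus 2 L) (w : Fock (Orb (FermionTorus 2 L)))
    (hw : w ∈ szSector ((halfRectN n L - 1) + (halfRectN n L - 1))
      ((((halfRectN n L - 1 : ℕ) : ℝ) - ((halfRectN n L - 1 : ℕ) : ℝ)) / 2)) :
    (annihilation (orb u 0) * annihilation (orb v 1))ᴴ *ᵥ w ∈ szSector (rectN n L) (0 : ℝ) := by
  rw [conjTranspose_mul, annihilation_conjTranspose, annihilation_conjTranspose, mem_szSector_rectN_iff,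
    ← mulVec_mulVec]
  have hw' : IsInSector (halfRectN n L - 1) (halfRectN n L - 1) w :=
    (mem_szSector_iff_isInSector _ _ w).1 hw
  have h := (hw'.creation_up_mulVec u).creation_down_mulVec v
  rw [Nat.sub_add_cancel hk] at h
  exact h

omit [NeZero L] in
/-- `k_L = halfRectN n L ≥ 1` as soon as `n·L ≥ 2` (`0 < n`, `1 ≤ L`). [folklore] -/
private theorem one_le_halfRectN_of_le' {n : ℝ} (hn : 0 < n) (hL1 : 1 ≤ L) (hL : 2 ≤ n * L) :
    1 ≤ halfRectN n L := by
  unfold halfRectN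
  rw [Nat.le_floor_iff (by positivity)]
  have hL' : (1 : ℝ) ≤ L := by exact_mod_cast hL1
  have : n * L ≤ n * (L : ℝ) ^ 2 := by
    rw [sq]
    exact mul_le_mul_of_nonneg_left (le_mul_of_one_le_right (by positivity) hL') hn.le
  push_cast
  linarith

omit [NeZero L] in
/-- Along `Ls → ∞`, eventually `1 ≤ halfRectN n (Ls j)` for `0 < n`. [folklore] -/
private theorem eventually_one_le_halfRectN' {n : ℝ} (hn : 0 < n) {Ls : ℕ → ℕ} (hLs : Tendsto Ls atTop atTop) :
    ∀ᶠ j in atTop, 1 ≤ halfRectN n (Ls j) := by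
  filter_upwards [hLs.eventually_ge_atTop (⌈2 / n⌉₊ + 1)] with j hj
  refine one_le_halfRectN_of_le' (Ls j) hn (by omega) ?_
  have h1 : (⌈2 / n⌉₊ : ℝ) + 1 ≤ Ls j := by exact_mod_cast hj
  have h2 : 2 / n ≤ ⌈2 / n⌉₊ := Nat.le_ceil _
  have h3 : 2 / n ≤ (Ls j : ℝ) := by linarith
  have := mul_le_mul_of_nonneg_left h3 hn.le
  rwa [mul_div_cancel₀ _ hn.ne'] at this

end Pair

/-! ### §2 The pair row for the thermal object of record -/

section Record

variable (t t' U β : ℝ)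

/-- **The two-sector row of the pair annihilator `c_{x↑}c_{y↓}` for the thermal object of record.** Let
`ω` be a torus limit of the canonical Gibbs states of `hubbardTorusTT' (Ls j) t t' U` at inverse
temperature `β` on the sectors `(rectN n (Ls j), S^z = 0)` along `Ls → ∞` (`0 < n`), let `ω'` be a torus
limit ALONG THE SAME `Ls` of the canonical Gibbs states on the `S^z = 0` sectors `(k_L − 1, k_L − 1)`
(`k_L = halfRectN n L`), and `r = lim_j Z_{(k−1,k−1)}(Ls j)/Z_{(k,k)}(Ls j)`. Then for `x, y ∈ Λ`,
`P̃ = Γ_{Λ⊆Λ₁}(c_{x↑}c_{y↓})`, `Λ₁ = thicken Λ 1`, and all real `s, q` with `e^{s−1} ≤ q`: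
`0 ≤ β·Re ω_{Λ₁}(P̃ᴴ(H^{tt'U}_{Λ₁}P̃ − P̃H^{tt'U}_{Λ₁})) − s·Re ω_{Λ₁}(P̃ᴴP̃) + q·r·Re ω'_{Λ₁}(P̃P̃ᴴ)` — the pair
(charge `−2`, spin `0`) row of a thermal relaxation for the canonical object, sector mapping discharged.
[cite: FawziFawziScalet2024, Thm. 3.1] [cite: BratteliRobinsonII1997, §5.4.2]
[cite: LiebPRL1989, proof of Theorem 1] -/
theorem InfVolFermionState.IsTorusLimitOfMixture.re_expect_twoSector_eeb_pairAnnihilation_nonneg_of_sectorGibbs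
    {n : ℝ} (hn : 0 < n) {Ls : ℕ → ℕ} (hLs : Tendsto Ls atTop atTop) {ω ω' : InfVolFermionState 2}
    (hω : ω.IsTorusLimitOfMixture (sectorGibbsCount n) (fun L => sectorGibbsWeightTT' β t t' U n L)
      (fun L => sectorGibbsVectorTT' t t' U n L) Ls)
    (hω' : ω'.IsTorusLimitOfMixture
      (fun L => Fintype.card (Subtype (spinConfig (Λ := FermionTorus 2 L) (halfRectN n L - 1) (halfRectN n L - 1))))
      (fun L i => canonicalWeight β (sectorEigenvalue (spinConfig (halfRectN n L - 1) (halfRectN n L - 1))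
        (hubbardTorusTT' L t t' U) (hubbardTorusTT'_isHermitian L t t' U)) ((Fintype.equivFin _).symm i))
      (fun L i => sectorEigenvector (spinConfig (halfRectN n L - 1) (halfRectN n L - 1)) (hubbardTorusTT' L t t' U)
        (hubbardTorusTT'_isHermitian L t t' U) ((Fintype.equivFin _).symm i)) Ls)
    {r : ℝ} (hr : Tendsto (fun j =>
      (∑ d, Real.exp (-(β * sectorEigenvalue (spinConfig (halfRectN n (Ls j) - 1) (halfRectN n (Ls j) - 1))
          (hubbardTorusTT' (Ls j) t t' U) (hubbardTorusTT'_isHermitian (Ls j) t t' U) d))) /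
        ∑ c, Real.exp (-(β * sectorEigenvalue (szConfig n (Ls j)) (hubbardTorusTT' (Ls j) t t' U)
          (hubbardTorusTT'_isHermitian (Ls j) t t' U) c))) atTop (𝓝 r))
    {Λ : Finset (Site 2)} {x y : Site 2} (hx : x ∈ Λ) (hy : y ∈ Λ) {s q : ℝ} (hq : Real.exp (s - 1) ≤ q) :
    0 ≤ β * (ω.expect (thicken Λ 1)
          ((fermionEmbed (PolySite.incl (subset_thicken Λ 1))
              (annihilation (orb (PolySite.pt x hx) 0) * annihilation (orb (PolySite.pt y hy) 1)))ᴴ *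
            ((hubbardTTPrimeFermionInteraction t t' U).localHamiltonian (thicken Λ 1) *
                fermionEmbed (PolySite.incl (subset_thicken Λ 1))
                  (annihilation (orb (PolySite.pt x hx) 0) * annihilation (orb (PolySite.pt y hy) 1)) -
              fermionEmbed (PolySite.incl (subset_thicken Λ 1))
                  (annihilation (orb (PolySite.pt x hx) 0) * annihilation (orb (PolySite.pt y hy) 1)) *
                (hubbardTTPrimeFermionInteraction t t' U).localHamiltonian (thicken Λ 1)))).re -
        s * (ω.expect (thicken Λ 1)
          ((fermionEmbed (PolySite.incl (subset_thicken Λ 1))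
              (annihilation (orb (PolySite.pt x hx) 0) * annihilation (orb (PolySite.pt y hy) 1)))ᴴ *
            fermionEmbed (PolySite.incl (subset_thicken Λ 1))
              (annihilation (orb (PolySite.pt x hx) 0) * annihilation (orb (PolySite.pt y hy) 1)))).re +
        q * r * (ω'.expect (thicken Λ 1)
          (fermionEmbed (PolySite.incl (subset_thicken Λ 1))
              (annihilation (orb (PolySite.pt x hx) 0) * annihilation (orb (PolySite.pt y hy) 1)) *
            (fermionEmbed (PolySite.incl (subset_thicken Λ 1))
              (annihilation (orb (PolySite.pt x hx) 0) * annihilation (orb (PolySite.pt y hy) 1)))ᴴ)).re := by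
  have hwrec : ∀ L (i : Fin (sectorGibbsCount n L)), sectorGibbsWeightTT' β t t' U n L i =
      canonicalWeight β (sectorEigenvalue (szConfig n L) (hubbardTorusTT' L t t' U)
        (hubbardTorusTT'_isHermitian L t t' U)) (sectorGibbsIndex n L i) := by
    intro L i
    rw [sectorGibbsWeightTT', show sectorGibbsEnergyTT' t t' U n L =
      sectorEigenvalue (szConfig n L) (hubbardTorusTT' L t t' U) (hubbardTorusTT'_isHermitian L t t' U) ∘
        sectorGibbsIndex n L from rfl]
    unfold canonicalWeight
    rw [show (∑ b, Real.exp (-(β * (sectorEigenvalue (szConfig n L) (hubbardTorusTT' L t t' U)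
        (hubbardTorusTT'_isHermitian L t t' U) ∘ sectorGibbsIndex n L) b))) =
      ∑ b, Real.exp (-(β * sectorEigenvalue (szConfig n L) (hubbardTorusTT' L t t' U)
        (hubbardTorusTT'_isHermitian L t t' U) b)) from
      Equiv.sum_comp (sectorGibbsIndex n L) (fun b => Real.exp (-(β * sectorEigenvalue (szConfig n L)
        (hubbardTorusTT' L t t' U) (hubbardTorusTT'_isHermitian L t t' U) b)))]
    rfl
  refine InfVolFermionState.re_expect_twoSector_eeb_nonneg_of_canonical_limits_eventually t t' U β
    (fun L => szConfig n L)
    (fun L => spinConfig (Λ := FermionTorus 2 L) (halfRectN n L - 1) (halfRectN n L - 1))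
    (fun L s s' hs hs' => hubbardTorusTT'_apply_eq_zero_of_szConfig L t t' U n s s' hs hs')
    (fun L s s' hs hs' => hubbardTorusTT'_apply_eq_zero_of_spinConfig L t t' U _ _ s s' hs hs')
    (fun L _ v s s' hs hs' => fockTranslate_apply_eq_zero_of_szConfig L v n s s' hs hs')
    (fun L _ v s s' hs hs' => fockTranslate_apply_eq_zero_of_spinConfig L v _ _ s s' hs hs')
    (fun L => sectorGibbsIndex n L) (fun L => (Fintype.equivFin _).symm)
    hwrec (fun L i => rfl) (fun L i => rfl) (fun L i => rfl) hLs hω hω' hr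
    (annihilation (orb (PolySite.pt x hx) 0) * annihilation (orb (PolySite.pt y hy) 1)) ?_ ?_ hq
  · filter_upwards [eventually_one_le_halfRectN' hn hLs] with j hk hL h₁ s s' hs hs'
    rw [fermionEmbed_toTorusEmb_incl_pairAnnihilation]
    exact apply_eq_zero_off_of_mulVec_mem₂ (szConfig n (Ls j)) (spinConfig _ _)
      (szSector (rectN n (Ls j)) 0) (szSector _ _) (mem_szSector_rectN_iff n (Ls j))
      (mem_szSector_iff_spinConfig (Ls j) _ _)
      (fun w hw => pairAnnihilation_mulVec_mem_szSector_pred (Ls j) hk _ _ w hw) s s' hs hs'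
  · filter_upwards [eventually_one_le_halfRectN' hn hLs] with j hk hL h₁ s s' hs hs'
    rw [fermionEmbed_toTorusEmb_incl_pairAnnihilation]
    exact apply_eq_zero_off_of_mulVec_mem₂ (spinConfig _ _) (szConfig n (Ls j))
      (szSector _ _) (szSector (rectN n (Ls j)) 0) (mem_szSector_iff_spinConfig (Ls j) _ _)
      (mem_szSector_rectN_iff n (Ls j))
      (fun w hw => pairAnnihilation_conjTranspose_mulVec_mem_szSector_rectN (Ls j) hk _ _ w hw) s s' hs hs'

end Record

end Literature.MathematicalPhysics.QuantumLattice

end
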